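import Literature.Probability.RandomPlanarGeometry.HexSAWStripWidthThreeContactSkewness
import Literature.Probability.RandomPlanarGeometry.HexSAWStripWidthThreeHatFourthContactAnnihilator
import Literature.Analysis.Asymptotics.LinearRecurrenceCubicSource
import HarnessLib

/-!
# The width-three strip at criticality: the fourth-power contact sums `Ĉ⁴(n+1)_{ab}` of `S₃` grow QUARTICALLY with forced leading coefficient `c⁴A`, and the
# Bell-polynomial constant `κ̂₄(T = 3)` (module «WIDTH-THREE FOURTH CONTACT MOMENT»)

Topic `Literature/Probability/RandomPlanarGeometry` (continues «WIDTH-THREE CONTACT SKEWNESS»/«THIRD CONTACT MOMENT» — `W3.exists_hatC3D_three_cubic`, `W3.kappaHatThree`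
(`κ̂₃`), `W3.cThree`, `W3.cTwoThree`, `W3.linQThree`, `W3.cubA/B/CThree`, the scalars `tOneThree … tyyyThree` —, «WIDTH-THREE HAT FOURTH CONTACT ANNIHILATOR»
(`W3.hatC4D`, `W3.detYDDDDot`, `W3.detY_contact_fourth_annihilator`) and the model-free «LINEAR RECURRENCE WITH CUBIC SOURCE»
(`Literature.Analysis.exists_abs_sub_quartic_le_of_linearRecurrence_one_real`)).  Lane «pcv-sawmu» (CriticalPhenomena venture), a-p2 g29.  The `T = 3` twin of
«WIDTH-TWO FOURTH CONTACT MOMENT», with the one structural difference that `det P(λ; y)` of `S₃` is NOT affine in `y`: the four derivative levels `ṫ, ẗ, t⃛, t⁗`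
are distinct and five new scalars enter (`Σr³ṫ`, `Σr²ẗ`, `Σrt⃛`, `T_yyyy`, `T₄`).  Fourth `y∂_y`: `Σ t_rĈ⁴ = −4Σ ṫĈ³ − 6Σ ẗĈ² − 4Σ t⃛Ĉ − Σ t⁗D̂`, a CUBIC source up to
`(n+1)^{92}Rⁿ`, hence `Ĉ⁴(n+1) = (α₄/4)n⁴ + … + m₄ + O((n+1)^{115}Rⁿ)`.  THE BELL FORMULA defining `κ̂₄`: with `M_{ij} = Σ_r r^i (y∂_y)^j t_r` at `(1, y₃)`
(`M₂₀ = T_λλ + T_λ`, `M₃₀ = T_λλλ + 3T_λλ + T_λ`, `M₄₀ = T₄ + 6T_λλλ + 7T_λλ + T_λ`) the cumulants `L_j` of `log λ(y₃e^t)` per hat index satisfy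
`L₄M₁₀ + 4L₃(L₁M₂₀ + M₁₁) + 3L₂²M₂₀ + 6L₂(L₁²M₃₀ + 2L₁M₂₁ + M₁₂) + L₁⁴M₄₀ + 4L₁³M₃₁ + 6L₁²M₂₂ + 4L₁M₁₃ + M₀₄ = 0` (`L₁ = cThree`, `L₂ = cTwoThree − cThree²`,
`L₃ = kappaHatThree`).  Frame: W. Feller I (1968) XIII.6; R. P. Stanley EC1 §4.1; nothing below is printed.

## What is proved (namespace `…SAW.HV.W3`)
* §1 `trrryThree`, `trryyThree`, `tlyyyThree`, `tyyyyThree`, `tFourThree` (definitions; closed forms in «DET-P FOURTH SCALARS»), `sum_coeff_cube_qMonicThree`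
  (`Σ j³Q_j = T₄/4 + T_λλλ + T_λλ/2`).
* §2 `cubP3/P2/P1Three` (the cubic law in `n`-indexing), `quartSrc0…3Three`, `quartA/B/C/DThree`; ★ `kappaHatFourThree` (`L₄` by the Bell formula),
  `kappaStepFourThree := κ̂₄/2`; `fourthTopThree` (`m₄ − 3Var²` of the contact count of `S₃` bridges in the raw ratios).
* §3 `hatC4D_three_source`, `hatC4D_three_recurrence_bound`, ★★★ **`exists_hatC4D_three_quartic`** (the quartic law, errors `K(n+1)^{115}(97/100)ⁿ`).
The kurtosis law and the closed form of `κ₄(T=3)` follow in «WIDTH-THREE CONTACT KURTOSIS» / «… CLOSED FORM».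

Label: LANE THEOREM (own result of lane «pcv-sawmu», a-p2 g29, 2026-08-28; not in print).
-/

noncomputable section

open Finset Filter Topology Matrix Polynomial Literature.Probability.LatticeModels Literature.Probability.Percolation

namespace Literature.Probability.RandomPlanarGeometry.SAW

namespace HV

namespace W3

/-! ## §1 Five more scalars of `det P` and `Σ j³Q_j` -/

/-- `Σ_r r³·ṫ_r(y₃)`. [cite: Feller1968, XIII.6; lane «pcv-sawmu» a-p2 g29] -/
def trrryThree : ℝ := ∑ r ∈ range 25, (r : ℝ) ^ 3 * detYDot (stripYT 3) r

/-- `Σ_r r²·ẗ_r(y₃)`. [cite: Feller1968, XIII.6; lane «pcv-sawmu» a-p2 g29] -/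
def trryyThree : ℝ := ∑ r ∈ range 25, (r : ℝ) ^ 2 * detYDDot (stripYT 3) r

/-- `Σ_r r·t⃛_r(y₃)`. [cite: Feller1968, XIII.6; lane «pcv-sawmu» a-p2 g29] -/
def tlyyyThree : ℝ := ∑ r ∈ range 25, (r : ℝ) * detYDDDot (stripYT 3) r

/-- `T_yyyy := Σ_r t⁗_r(y₃)`. [cite: Feller1968, XIII.6; lane «pcv-sawmu» a-p2 g29] -/
def tyyyyThree : ℝ := ∑ r ∈ range 25, detYDDDDot (stripYT 3) r

/-- `T₄ := Σ_r r(r−1)(r−2)(r−3)·t_r(y₃)`. [cite: Stanley2012EC1, §4.1; lane «pcv-sawmu» a-p2 g29] -/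
def tFourThree : ℝ := ∑ r ∈ range 25, (r : ℝ) * ((r : ℝ) - 1) * ((r : ℝ) - 2) * ((r : ℝ) - 3) * detY (stripYT 3) r

/-- `Σ_{j ≤ 23} j³·Q_j = T₄/4 + T_λλλ + T_λλ/2` (bookkeeping with `d_m = m(m−1)(m−2)(m−3)`: `d_{j+1} − d_j = 4j(j−1)(j−2)`).
[cite: Stanley2012EC1, §4.1 Theorem 4.1.1; lane plumbing] -/
theorem sum_coeff_cube_qMonicThree :
    ∑ j ∈ range (qMonicThree.natDegree + 1), qMonicThree.coeff j * (j : ℂ) ^ 3 = ((tFourThree / 4 + tThreeThree + tTwoThree / 2 : ℝ) : ℂ) := by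
  obtain ⟨_, hdeg⟩ := qMonicThree_monic
  have hd := sum_coeff_mul_qMonicThree
  have hdd := sum_coeff_sq_qMonicThree
  rw [hdeg] at hd hdd ⊢
  have h := sum_coeff_X_sub_one_mul qMonicThree hdeg (fun m => (m : ℂ) * ((m : ℂ) - 1) * ((m : ℂ) - 2) * ((m : ℂ) - 3)) 0
  have lhs : ∑ j ∈ range 24, qMonicThree.coeff j * ((fun m : ℕ => (m : ℂ) * ((m : ℂ) - 1) * ((m : ℂ) - 2) * ((m : ℂ) - 3)) (0 + 1 + j))
      - ∑ j ∈ range 24, qMonicThree.coeff j * ((fun m : ℕ => (m : ℂ) * ((m : ℂ) - 1) * ((m : ℂ) - 2) * ((m : ℂ) - 3)) (0 + j))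
      = 4 * ∑ j ∈ range 24, qMonicThree.coeff j * (j : ℂ) ^ 3 - 12 * ∑ j ∈ range 24, qMonicThree.coeff j * (j : ℂ) ^ 2
        + 8 * ∑ j ∈ range 24, qMonicThree.coeff j * (j : ℂ) := by
    rw [Finset.mul_sum, Finset.mul_sum, Finset.mul_sum, ← Finset.sum_sub_distrib, ← Finset.sum_sub_distrib, ← Finset.sum_add_distrib]
    refine Finset.sum_congr rfl fun j _ => ?_
    push_cast; ring
  have rhs : ∑ r ∈ range 25, ((X - C 1) * qMonicThree).coeff r * ((fun m : ℕ => (m : ℂ) * ((m : ℂ) - 1) * ((m : ℂ) - 2) * ((m : ℂ) - 3)) (0 + r))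
      = ((tFourThree : ℝ) : ℂ) := by
    unfold tFourThree
    rw [Complex.ofReal_sum]
    refine Finset.sum_congr rfl fun r hr => ?_
    rw [X_sub_one_mul_qMonicThree_coeff r (Finset.mem_range.1 hr)]
    push_cast; ring
  have e : 4 * ∑ j ∈ range 24, qMonicThree.coeff j * (j : ℂ) ^ 3 - 12 * ∑ j ∈ range 24, qMonicThree.coeff j * (j : ℂ) ^ 2
      + 8 * ∑ j ∈ range 24, qMonicThree.coeff j * (j : ℂ) = ((tFourThree : ℝ) : ℂ) :=
    lhs.symm.trans (h.trans rhs)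
  rw [show (23 : ℕ) + 1 = 24 from rfl] at hd hdd
  rw [hd, hdd] at e
  push_cast at e ⊢
  linear_combination e / 4

/-! ## §2 Constants and the statistic -/

/-- Leading coefficients of the cubic law of `Ĉ³(n+1)` in `n`-indexing: `p₃ = α/3`, `p₂ = (β−α)/2`, `p₁ = α/6 − β/2 + γ` (plumbing). [cite: Feller1968, XIII.6; lane «pcv-sawmu» a-p2 g29] -/
def cubP3Three (A : ℝ) : ℝ := cubAThree A / 3
/-- see `cubP3Three`. [cite: Feller1968, XIII.6; lane «pcv-sawmu» a-p2 g29] -/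
def cubP2Three (A m₀ : ℝ) : ℝ := (cubBThree A m₀ - cubAThree A) / 2
/-- see `cubP3Three`. [cite: Feller1968, XIII.6; lane «pcv-sawmu» a-p2 g29] -/
def cubP1Three (A m₀ m₂ : ℝ) : ℝ := cubAThree A / 6 - cubBThree A m₀ / 2 + cubCThree A m₀ m₂

/-- Source coefficients of the `Ĉ⁴` recurrence: `ℓ₃ˢ = −4p₃T_y`. [cite: Feller1968, XIII.6; lane «pcv-sawmu» a-p2 g29] -/
def quartSrc3Three (A : ℝ) : ℝ := -4 * cubP3Three A * tyThree
/-- `ℓ₂ˢ = −4(3p₃T_λy + p₂T_y) − 6c²A·T_yy`. [cite: Feller1968, XIII.6; lane «pcv-sawmu» a-p2 g29] -/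
def quartSrc2Three (A m₀ : ℝ) : ℝ := -4 * (3 * cubP3Three A * tlyThree + cubP2Three A m₀ * tyThree) - 6 * (cThree ^ 2 * A) * tyyThree
/-- `ℓ₁ˢ = −4(3p₃Σr²ṫ + 2p₂T_λy + p₁T_y) − 6(2c²A·Σrẗ + ℓT_yy) − 4cA·T_yyy`. [cite: Feller1968, XIII.6; lane «pcv-sawmu» a-p2 g29] -/
def quartSrc1Three (A m₀ m₂ : ℝ) : ℝ :=
  -4 * (3 * cubP3Three A * trryThree + 2 * cubP2Three A m₀ * tlyThree + cubP1Three A m₀ m₂ * tyThree)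
    - 6 * (2 * (cThree ^ 2 * A) * tlyyThree + linQThree A m₀ * tyyThree) - 4 * (cThree * A) * tyyyThree
/-- `ℓ₀ˢ = −4(p₃Σr³ṫ + p₂Σr²ṫ + p₁T_λy + m₃T_y) − 6(c²AΣr²ẗ + ℓΣrẗ + m₂T_yy) − 4(cA·Σrt⃛ + m₀T_yyy) − T_yyyy·A`. [cite: Feller1968, XIII.6; lane «pcv-sawmu» a-p2 g29] -/
def quartSrc0Three (A m₀ m₂ m₃ : ℝ) : ℝ :=
  -4 * (cubP3Three A * trrryThree + cubP2Three A m₀ * trryThree + cubP1Three A m₀ m₂ * tlyThree + m₃ * tyThree)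
    - 6 * ((cThree ^ 2 * A) * trryyThree + linQThree A m₀ * tlyyThree + m₂ * tyyThree) - 4 * ((cThree * A) * tlyyyThree + m₀ * tyyyThree)
    - tyyyyThree * A

/-- `α₄ = ℓ₃ˢ/T_λ`. [cite: Stanley2012EC1, §4.1; lane «pcv-sawmu» a-p2 g29] -/
def quartAThree (A : ℝ) : ℝ := quartSrc3Three A / tOneThree
/-- `β₄ = (ℓ₂ˢ − 3α₄·T_λλ/2)/T_λ`. [cite: Stanley2012EC1, §4.1; lane «pcv-sawmu» a-p2 g29] -/
def quartBThree (A m₀ : ℝ) : ℝ := (quartSrc2Three A m₀ - 3 * quartAThree A * (tTwoThree / 2)) / tOneThree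
/-- `γ₄ = (ℓ₁ˢ − 3α₄Q_dd − 2β₄Q_d)/T_λ`. [cite: Stanley2012EC1, §4.1; lane «pcv-sawmu» a-p2 g29] -/
def quartCThree (A m₀ m₂ : ℝ) : ℝ :=
  (quartSrc1Three A m₀ m₂ - 3 * quartAThree A * (tThreeThree / 3 + tTwoThree / 2) - 2 * quartBThree A m₀ * (tTwoThree / 2)) / tOneThree
/-- `δ₄ = (ℓ₀ˢ − α₄Q_ddd − β₄Q_dd − γ₄Q_d)/T_λ`. [cite: Stanley2012EC1, §4.1; lane «pcv-sawmu» a-p2 g29] -/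
def quartDThree (A m₀ m₂ m₃ : ℝ) : ℝ :=
  (quartSrc0Three A m₀ m₂ m₃ - quartAThree A * (tFourThree / 4 + tThreeThree + tTwoThree / 2) - quartBThree A m₀ * (tThreeThree / 3 + tTwoThree / 2)
    - quartCThree A m₀ m₂ * (tTwoThree / 2)) / tOneThree

/-- ★ `κ̂₄(T=3)` by the Bell formula of the module docstring (`L₁ = cThree`, `L₂ = cTwoThree − cThree²`, `L₃ = kappaHatThree`; plain power moments `M_{ij} = Σ r^i (y∂_y)^j t_r`
from the falling-factorial scalars; `M₁₂ = Σrẗ`, `M₂₂ = Σr²ẗ`, `M₁₃ = Σrt⃛`, `M₀₄ = T_yyyy`). [cite: Feller1968, XIII.6; lane «pcv-sawmu» a-p2 g29] -/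
def kappaHatFourThree : ℝ :=
  -(4 * kappaHatThree * (cThree * (tTwoThree + tOneThree) + tlyThree) + 3 * (cTwoThree - cThree ^ 2) ^ 2 * (tTwoThree + tOneThree)
      + 6 * (cTwoThree - cThree ^ 2) * (cThree ^ 2 * (tThreeThree + 3 * tTwoThree + tOneThree) + 2 * cThree * trryThree + tlyyThree)
      + cThree ^ 4 * (tFourThree + 6 * tThreeThree + 7 * tTwoThree + tOneThree) + 4 * cThree ^ 3 * trrryThree + 6 * cThree ^ 2 * trryyThree
      + 4 * cThree * tlyyyThree + tyyyyThree) / tOneThree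

/-- ★ `κ₄(T=3) := κ̂₄/2` per step. [cite: Feller1968, XIII.6; lane «pcv-sawmu» a-p2 g29] -/
def kappaStepFourThree : ℝ := kappaHatFourThree / 2

/-- The fourth cumulant statistic `m₄ − 3Var²` of the number of surface contacts of a bridge `a → b` of `S₃` with hat index `k` under the critical weights,
written in the raw ratios: `Ĉ⁴/D̂ − 4(Ĉ³/D̂)(Ĉ/D̂) − 3(Ĉ²/D̂)² + 12(Ĉ²/D̂)(Ĉ/D̂)² − 6(Ĉ/D̂)⁴`. [cite: Feller1968, XIII.6; lane «pcv-sawmu» a-p2 g29] -/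
def fourthTopThree (k : ℕ) (a b : Fin (2 * 3)) : ℝ :=
  hatC4D (stripYT 3) k a b / hatD 3 (stripYT 3) k a b - 4 * (hatC3D (stripYT 3) k a b / hatD 3 (stripYT 3) k a b) * meanTopThree k a b
    - 3 * (hatC2D (stripYT 3) k a b / hatD 3 (stripYT 3) k a b) ^ 2 + 12 * (hatC2D (stripYT 3) k a b / hatD 3 (stripYT 3) k a b) * meanTopThree k a b ^ 2
    - 6 * meanTopThree k a b ^ 4

/-! ## §3 The quartic law of `Ĉ⁴` -/

/-- The source of the `Ĉ⁴` recurrence of `S₃` in terms of the lower-moment errors (from `detY_contact_fourth_annihilator`).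
[cite: Feller1968, XIII.6; lane «pcv-sawmu» a-p2 g29] -/
theorem hatC4D_three_source (a b : Fin (2 * 3)) (m₀ m₂ m₃ : ℝ) (n : ℕ) :
    ∑ r ∈ range 25, detY (stripYT 3) r * hatC4D (stripYT 3) (n + r + 1) a b
        - (quartSrc3Three (limDThree a b) * (n : ℝ) ^ 3 + quartSrc2Three (limDThree a b) m₀ * (n : ℝ) ^ 2
          + quartSrc1Three (limDThree a b) m₀ m₂ * (n : ℝ) + quartSrc0Three (limDThree a b) m₀ m₂ m₃)
      = -(4 * ∑ r ∈ range 25, detYDot (stripYT 3) r * (hatC3D (stripYT 3) (n + r + 1) a b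
            - (cubP3Three (limDThree a b) * ((n + r : ℕ) : ℝ) ^ 3 + cubP2Three (limDThree a b) m₀ * ((n + r : ℕ) : ℝ) ^ 2
              + cubP1Three (limDThree a b) m₀ m₂ * ((n + r : ℕ) : ℝ) + m₃))
          + 6 * ∑ r ∈ range 25, detYDDot (stripYT 3) r * (hatC2D (stripYT 3) (n + r + 1) a b
            - (cThree ^ 2 * limDThree a b * ((n + r : ℕ) : ℝ) ^ 2 + linQThree (limDThree a b) m₀ * ((n + r : ℕ) : ℝ) + m₂))
          + 4 * ∑ r ∈ range 25, detYDDDot (stripYT 3) r * (hatCD (stripYT 3) (n + r + 1) a b - (cThree * limDThree a b * ((n + r : ℕ) : ℝ) + m₀))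
          + ∑ r ∈ range 25, detYDDDDot (stripYT 3) r * (hatD 3 (stripYT 3) (n + r + 1) a b - limDThree a b)) := by
  have hy : 0 < stripYT 3 := by linarith [stripYT_three_bounds.1]
  have h := detY_contact_fourth_annihilator hy a b n
  set A := limDThree a b with hA
  set ℓ := linQThree A m₀ with hℓ
  set p₃ := cubP3Three A with hp₃
  set p₂ := cubP2Three A m₀ with hp₂
  set p₁ := cubP1Three A m₀ m₂ with hp₁
  have e3 : ∑ r ∈ range 25, detYDot (stripYT 3) r * (hatC3D (stripYT 3) (n + r + 1) a b
        - (p₃ * ((n + r : ℕ) : ℝ) ^ 3 + p₂ * ((n + r : ℕ) : ℝ) ^ 2 + p₁ * ((n + r : ℕ) : ℝ) + m₃))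
      = ∑ r ∈ range 25, detYDot (stripYT 3) r * hatC3D (stripYT 3) (n + 1 + r) a b
        - (p₃ * ((n : ℝ) ^ 3 * tyThree + 3 * (n : ℝ) ^ 2 * tlyThree + 3 * (n : ℝ) * trryThree + trrryThree)
          + p₂ * ((n : ℝ) ^ 2 * tyThree + 2 * (n : ℝ) * tlyThree + trryThree) + p₁ * ((n : ℝ) * tyThree + tlyThree) + m₃ * tyThree) := by
    rw [tyThree, tlyThree, trryThree, trrryThree]
    simp only [Finset.mul_sum, ← Finset.sum_add_distrib, ← Finset.sum_sub_distrib, mul_add]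
    refine Finset.sum_congr rfl fun r _ => ?_
    rw [show n + r + 1 = n + 1 + r by ring]; push_cast; ring
  have e2 : ∑ r ∈ range 25, detYDDot (stripYT 3) r * (hatC2D (stripYT 3) (n + r + 1) a b
        - (cThree ^ 2 * A * ((n + r : ℕ) : ℝ) ^ 2 + ℓ * ((n + r : ℕ) : ℝ) + m₂))
      = ∑ r ∈ range 25, detYDDot (stripYT 3) r * hatC2D (stripYT 3) (n + 1 + r) a b
        - (cThree ^ 2 * A * ((n : ℝ) ^ 2 * tyyThree + 2 * (n : ℝ) * tlyyThree + trryyThree) + ℓ * ((n : ℝ) * tyyThree + tlyyThree)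
          + m₂ * tyyThree) := by
    rw [tyyThree, tlyyThree, trryyThree]
    simp only [Finset.mul_sum, ← Finset.sum_add_distrib, ← Finset.sum_sub_distrib, mul_add]
    refine Finset.sum_congr rfl fun r _ => ?_
    rw [show n + r + 1 = n + 1 + r by ring]; push_cast; ring
  have e1 : ∑ r ∈ range 25, detYDDDot (stripYT 3) r * (hatCD (stripYT 3) (n + r + 1) a b - (cThree * A * ((n + r : ℕ) : ℝ) + m₀))
      = ∑ r ∈ range 25, detYDDDot (stripYT 3) r * hatCD (stripYT 3) (n + 1 + r) a b
        - (cThree * A * ((n : ℝ) * tyyyThree + tlyyyThree) + m₀ * tyyyThree) := by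
    rw [tyyyThree, tlyyyThree]
    simp only [Finset.mul_sum, ← Finset.sum_add_distrib, ← Finset.sum_sub_distrib, mul_add]
    refine Finset.sum_congr rfl fun r _ => ?_
    rw [show n + r + 1 = n + 1 + r by ring]; push_cast; ring
  have e0 : ∑ r ∈ range 25, detYDDDDot (stripYT 3) r * (hatD 3 (stripYT 3) (n + r + 1) a b - A)
      = ∑ r ∈ range 25, detYDDDDot (stripYT 3) r * hatD 3 (stripYT 3) (n + 1 + r) a b - tyyyyThree * A := by
    rw [tyyyyThree, Finset.sum_mul, ← Finset.sum_sub_distrib]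
    exact Finset.sum_congr rfl fun r _ => by rw [show n + r + 1 = n + 1 + r by ring]; ring
  have e4 : ∑ r ∈ range 25, detY (stripYT 3) r * hatC4D (stripYT 3) (n + r + 1) a b
      = ∑ r ∈ range 25, detY (stripYT 3) r * hatC4D (stripYT 3) (n + 1 + r) a b :=
    Finset.sum_congr rfl fun r _ => by rw [show n + r + 1 = n + 1 + r by ring]
  rw [e3, e2, e1, e0, e4, quartSrc3Three, quartSrc2Three, quartSrc1Three, quartSrc0Three]
  linear_combination h

/-- The recurrence-with-source estimate for `Ĉ⁴(n+1)_{ab}` of `S₃`. [cite: Feller1968, XIII.6; Stanley2012EC1, §4.1 Theorem 4.1.1 (iii); lane «pcv-sawmu» a-p2 g29] -/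
theorem hatC4D_three_recurrence_bound (a b : Fin (2 * 3)) {m₀ m₂ m₃ K₁ : ℝ} (hK₁ : 0 ≤ K₁)
    (hb₁ : ∀ n : ℕ, |hatCD (stripYT 3) (n + 1) a b - (cThree * limDThree a b * (n : ℝ) + m₀)| ≤ K₁ * ((n : ℝ) + 1) ^ 46 * (97 / 100 : ℝ) ^ n)
    (hb₂ : ∀ n : ℕ, |hatC2D (stripYT 3) (n + 1) a b - (cThree ^ 2 * limDThree a b * (n : ℝ) ^ 2 + linQThree (limDThree a b) m₀ * (n : ℝ) + m₂)|
      ≤ K₁ * ((n : ℝ) + 1) ^ 69 * (97 / 100 : ℝ) ^ n)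
    (hb₃ : ∀ n : ℕ, |hatC3D (stripYT 3) (n + 1) a b - (cubP3Three (limDThree a b) * (n : ℝ) ^ 3 + cubP2Three (limDThree a b) m₀ * (n : ℝ) ^ 2
      + cubP1Three (limDThree a b) m₀ m₂ * (n : ℝ) + m₃)| ≤ K₁ * ((n : ℝ) + 1) ^ 92 * (97 / 100 : ℝ) ^ n) :
    ∃ K : ℝ, 0 ≤ K ∧ ∀ n : ℕ,
    ‖∑ j ∈ range (qMonicThree.natDegree + 1), qMonicThree.coeff j
        * (((hatC4D (stripYT 3) (n + 1 + j + 1) a b : ℝ) : ℂ) - ((hatC4D (stripYT 3) (n + j + 1) a b : ℝ) : ℂ))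
        - (((quartSrc3Three (limDThree a b) : ℝ) : ℂ) * (n : ℂ) ^ 3 + ((quartSrc2Three (limDThree a b) m₀ : ℝ) : ℂ) * (n : ℂ) ^ 2
          + ((quartSrc1Three (limDThree a b) m₀ m₂ : ℝ) : ℂ) * (n : ℂ) + ((quartSrc0Three (limDThree a b) m₀ m₂ m₃ : ℝ) : ℂ))‖
      ≤ K * ((n : ℝ) + 1) ^ 92 * (97 / 100 : ℝ) ^ n := by
  obtain ⟨K₀, hK₀⟩ := abs_hatD_three_sub_lim_le
  have hK₀' : 0 ≤ K₀ := nonneg_of_abs_hatD_bound (hK₀ a b)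
  set S₃ : ℝ := K₁ * ∑ r ∈ range 25, |detYDot (stripYT 3) r| * ((r : ℝ) + 1) ^ 92 with hS₃
  set S₂ : ℝ := K₁ * ∑ r ∈ range 25, |detYDDot (stripYT 3) r| * ((r : ℝ) + 1) ^ 69 with hS₂
  set S₁ : ℝ := K₁ * ∑ r ∈ range 25, |detYDDDot (stripYT 3) r| * ((r : ℝ) + 1) ^ 46 with hS₁
  set S₀ : ℝ := K₀ * ∑ r ∈ range 25, |detYDDDDot (stripYT 3) r| * ((r : ℝ) + 1) ^ 23 with hS₀
  have hS₃0 : 0 ≤ S₃ := mul_nonneg hK₁ (Finset.sum_nonneg fun r _ => by positivity)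
  have hS₂0 : 0 ≤ S₂ := mul_nonneg hK₁ (Finset.sum_nonneg fun r _ => by positivity)
  have hS₁0 : 0 ≤ S₁ := mul_nonneg hK₁ (Finset.sum_nonneg fun r _ => by positivity)
  have hS₀0 : 0 ≤ S₀ := mul_nonneg hK₀' (Finset.sum_nonneg fun r _ => by positivity)
  refine ⟨4 * S₃ + 6 * S₂ + 4 * S₁ + S₀, by linarith, fun n => ?_⟩
  rw [sum_coeff_qMonicThree_diff (fun m => hatC4D (stripYT 3) (m + 1) a b) n]
  rw [← Complex.ofReal_natCast, ← Complex.ofReal_pow, ← Complex.ofReal_pow, ← Complex.ofReal_mul, ← Complex.ofReal_mul, ← Complex.ofReal_mul,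
    ← Complex.ofReal_add, ← Complex.ofReal_add, ← Complex.ofReal_add, ← Complex.ofReal_sub, Complex.norm_real, Real.norm_eq_abs,
    hatC4D_three_source a b m₀ m₂ m₃ n, abs_neg]
  have h3 := abs_sum_mul_shift_le (g := fun r => detYDot (stripYT 3) r)
    (e := fun m => hatC3D (stripYT 3) (m + 1) a b - (cubP3Three (limDThree a b) * (m : ℝ) ^ 3 + cubP2Three (limDThree a b) m₀ * (m : ℝ) ^ 2
      + cubP1Three (limDThree a b) m₀ m₂ * (m : ℝ) + m₃)) (by norm_num) (by norm_num) hK₁ hb₃ n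
  have h2 := abs_sum_mul_shift_le (g := fun r => detYDDot (stripYT 3) r)
    (e := fun m => hatC2D (stripYT 3) (m + 1) a b - (cThree ^ 2 * limDThree a b * (m : ℝ) ^ 2 + linQThree (limDThree a b) m₀ * (m : ℝ) + m₂))
    (by norm_num) (by norm_num) hK₁ hb₂ n
  have h1 := abs_sum_mul_shift_le (g := fun r => detYDDDot (stripYT 3) r)
    (e := fun m => hatCD (stripYT 3) (m + 1) a b - (cThree * limDThree a b * (m : ℝ) + m₀)) (by norm_num) (by norm_num) hK₁ hb₁ n
  have h0 := abs_sum_mul_shift_le (g := fun r => detYDDDDot (stripYT 3) r) (e := fun m => hatD 3 (stripYT 3) (m + 1) a b - limDThree a b)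
    (by norm_num) (by norm_num) hK₀' (hK₀ a b) n
  rw [← hS₃] at h3
  rw [← hS₂] at h2
  rw [← hS₁] at h1
  rw [← hS₀] at h0
  have hn1 : (1 : ℝ) ≤ (n : ℝ) + 1 := by linarith [(Nat.cast_nonneg n : (0 : ℝ) ≤ n)]
  have hp2 : ((n : ℝ) + 1) ^ 69 * (97 / 100 : ℝ) ^ n ≤ ((n : ℝ) + 1) ^ 92 * (97 / 100 : ℝ) ^ n :=
    mul_le_mul_of_nonneg_right (pow_le_pow_right₀ hn1 (by norm_num)) (by positivity)
  have hp1 : ((n : ℝ) + 1) ^ 46 * (97 / 100 : ℝ) ^ n ≤ ((n : ℝ) + 1) ^ 92 * (97 / 100 : ℝ) ^ n :=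
    mul_le_mul_of_nonneg_right (pow_le_pow_right₀ hn1 (by norm_num)) (by positivity)
  have hp0 : ((n : ℝ) + 1) ^ 23 * (97 / 100 : ℝ) ^ n ≤ ((n : ℝ) + 1) ^ 92 * (97 / 100 : ℝ) ^ n :=
    mul_le_mul_of_nonneg_right (pow_le_pow_right₀ hn1 (by norm_num)) (by positivity)
  have h2' := h2.trans (mul_le_mul_of_nonneg_left hp2 hS₂0)
  have h1' := h1.trans (mul_le_mul_of_nonneg_left hp1 hS₁0)
  have h0' := h0.trans (mul_le_mul_of_nonneg_left hp0 hS₀0)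
  set X₃ := ∑ r ∈ range 25, detYDot (stripYT 3) r * (hatC3D (stripYT 3) (n + r + 1) a b
      - (cubP3Three (limDThree a b) * ((n + r : ℕ) : ℝ) ^ 3 + cubP2Three (limDThree a b) m₀ * ((n + r : ℕ) : ℝ) ^ 2
        + cubP1Three (limDThree a b) m₀ m₂ * ((n + r : ℕ) : ℝ) + m₃)) with hX₃
  set X₂ := ∑ r ∈ range 25, detYDDot (stripYT 3) r * (hatC2D (stripYT 3) (n + r + 1) a b
      - (cThree ^ 2 * limDThree a b * ((n + r : ℕ) : ℝ) ^ 2 + linQThree (limDThree a b) m₀ * ((n + r : ℕ) : ℝ) + m₂)) with hX₂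
  set X₁ := ∑ r ∈ range 25, detYDDDot (stripYT 3) r * (hatCD (stripYT 3) (n + r + 1) a b - (cThree * limDThree a b * ((n + r : ℕ) : ℝ) + m₀)) with hX₁
  set X₀ := ∑ r ∈ range 25, detYDDDDot (stripYT 3) r * (hatD 3 (stripYT 3) (n + r + 1) a b - limDThree a b) with hX₀
  set W := ((n : ℝ) + 1) ^ 92 * (97 / 100 : ℝ) ^ n with hW
  calc |4 * X₃ + 6 * X₂ + 4 * X₁ + X₀| ≤ |4 * X₃ + 6 * X₂ + 4 * X₁| + |X₀| := abs_add_le _ _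
    _ ≤ (|4 * X₃ + 6 * X₂| + |4 * X₁|) + |X₀| := by gcongr; exact abs_add_le _ _
    _ ≤ ((|4 * X₃| + |6 * X₂|) + |4 * X₁|) + |X₀| := by gcongr; exact abs_add_le _ _
    _ = 4 * |X₃| + 6 * |X₂| + 4 * |X₁| + |X₀| := by
        rw [abs_mul, abs_mul, abs_mul, abs_of_pos (by norm_num : (0 : ℝ) < 4), abs_of_pos (by norm_num : (0 : ℝ) < 6)]
    _ ≤ 4 * (S₃ * W) + 6 * (S₂ * W) + 4 * (S₁ * W) + S₀ * W := by gcongr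
    _ = (4 * S₃ + 6 * S₂ + 4 * S₁ + S₀) * ((n : ℝ) + 1) ^ 92 * (97 / 100 : ℝ) ^ n := by rw [hW]; ring

/-- ★★★ **The fourth-power contact sums of `S₃` grow quartically with forced leading coefficient `c⁴A`** (errors `K(n+1)^{115}Rⁿ`, `R = 97/100`): with the laws of
`Ĉ`, `Ĉ²`, `Ĉ³` of «CONTACT ASYMPTOTICS»/«THIRD CONTACT MOMENT» and constants `α₄ = quartAThree A`, …, `δ₄ = quartDThree A m₀ m₂ m₃`.
[cite: Feller1968, XIII.6; Stanley2012EC1, §4.1 Theorem 4.1.1 (iii); lane «pcv-sawmu» a-p2 g29 — own result, not in print] -/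
theorem exists_hatC4D_three_quartic (a b : Fin (2 * 3)) :
    ∃ m₀ m₂ m₃ m₄ K : ℝ,
      (∀ n : ℕ, |hatCD (stripYT 3) (n + 1) a b - (cThree * limDThree a b * (n : ℝ) + m₀)| ≤ K * ((n : ℝ) + 1) ^ 46 * (97 / 100 : ℝ) ^ n) ∧
      (∀ n : ℕ, |hatC2D (stripYT 3) (n + 1) a b - (cThree ^ 2 * limDThree a b * (n : ℝ) ^ 2 + linQThree (limDThree a b) m₀ * (n : ℝ) + m₂)|
        ≤ K * ((n : ℝ) + 1) ^ 69 * (97 / 100 : ℝ) ^ n) ∧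
      (∀ n : ℕ, |hatC3D (stripYT 3) (n + 1) a b - (cubP3Three (limDThree a b) * (n : ℝ) ^ 3 + cubP2Three (limDThree a b) m₀ * (n : ℝ) ^ 2
        + cubP1Three (limDThree a b) m₀ m₂ * (n : ℝ) + m₃)| ≤ K * ((n : ℝ) + 1) ^ 92 * (97 / 100 : ℝ) ^ n) ∧
      ∀ n : ℕ, |hatC4D (stripYT 3) (n + 1) a b - (quartAThree (limDThree a b) / 4 * (n : ℝ) ^ 4
          + (quartBThree (limDThree a b) m₀ / 3 - quartAThree (limDThree a b) / 2) * (n : ℝ) ^ 3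
          + (quartAThree (limDThree a b) / 4 - quartBThree (limDThree a b) m₀ / 2 + quartCThree (limDThree a b) m₀ m₂ / 2) * (n : ℝ) ^ 2
          + (quartBThree (limDThree a b) m₀ / 6 - quartCThree (limDThree a b) m₀ m₂ / 2 + quartDThree (limDThree a b) m₀ m₂ m₃) * (n : ℝ) + m₄)|
        ≤ K * ((n : ℝ) + 1) ^ 115 * (97 / 100 : ℝ) ^ n := by
  obtain ⟨hQm, hdeg⟩ := qMonicThree_monic
  have hT : tOneThree ≠ 0 := (exists_hatCD_three_linear a b).1
  obtain ⟨m₀, m₂, m₃, K₁, hb₁, hb₂, hb₃⟩ := exists_hatC3D_three_cubic a b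
  have hK₁ : 0 ≤ K₁ := by
    have h := hb₁ 0
    simp only [Nat.cast_zero, zero_add, mul_zero, one_pow, pow_zero, mul_one] at h
    exact (abs_nonneg _).trans h
  have hb₃' : ∀ n : ℕ, |hatC3D (stripYT 3) (n + 1) a b - (cubP3Three (limDThree a b) * (n : ℝ) ^ 3 + cubP2Three (limDThree a b) m₀ * (n : ℝ) ^ 2
      + cubP1Three (limDThree a b) m₀ m₂ * (n : ℝ) + m₃)| ≤ K₁ * ((n : ℝ) + 1) ^ 92 * (97 / 100 : ℝ) ^ n := fun n => by
    have h := hb₃ n; simp only [cubP3Three, cubP2Three, cubP1Three]; exact h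
  obtain ⟨K₂, hK₂, hw⟩ := hatC4D_three_recurrence_bound a b hK₁ hb₁ hb₂ hb₃'
  set A := limDThree a b with hA
  have hα : quartAThree A * tOneThree = quartSrc3Three A := by rw [quartAThree]; field_simp
  have hβ : quartBThree A m₀ * tOneThree = quartSrc2Three A m₀ - 3 * quartAThree A * (tTwoThree / 2) := by rw [quartBThree]; field_simp
  have hγ : quartCThree A m₀ m₂ * tOneThree = quartSrc1Three A m₀ m₂ - 3 * quartAThree A * (tThreeThree / 3 + tTwoThree / 2)
      - 2 * quartBThree A m₀ * (tTwoThree / 2) := by rw [quartCThree]; field_simp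
  have hδ : quartDThree A m₀ m₂ m₃ * tOneThree = quartSrc0Three A m₀ m₂ m₃ - quartAThree A * (tFourThree / 4 + tThreeThree + tTwoThree / 2)
      - quartBThree A m₀ * (tThreeThree / 3 + tTwoThree / 2) - quartCThree A m₀ m₂ * (tTwoThree / 2) := by rw [quartDThree]; field_simp
  obtain ⟨m₄, K₃, hK₃, hb₄⟩ := Literature.Analysis.exists_abs_sub_quartic_le_of_linearRecurrence_one_real
    (w := fun m => hatC4D (stripYT 3) (m + 1) a b) hQm (by norm_num) (by norm_num) (fun z hz => qMonicThree_root_norm_le hz)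
    sum_coeff_qMonicThree sum_coeff_mul_qMonicThree sum_coeff_sq_qMonicThree sum_coeff_cube_qMonicThree hα hβ hγ hδ hK₂ hw
  refine ⟨m₀, m₂, m₃, m₄, max K₁ K₃, fun n => (hb₁ n).trans ?_, fun n => (hb₂ n).trans ?_, fun n => (hb₃' n).trans ?_, fun n => ?_⟩
  · gcongr; exact le_max_left _ _
  · gcongr; exact le_max_left _ _
  · gcongr; exact le_max_left _ _
  have h := hb₄ n
  rw [hdeg] at h
  exact h.trans (by gcongr; exact le_max_right _ _)

end W3

end HV

end Literature.Probability.RandomPlanarGeometry.SAW
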